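import Mathlib
import HarnessLib
import Summits.Langlands.Langlands.Theses.SkinnerWilesDefectOne
import Literature.NumberTheory.Automorphic.CompletedCohomologyHeckeAlgebraGLn
import Literature.NumberTheory.Automorphic.CompletedCohomologyHeckeAlgebraGLnHolds

/-!
# Identities among the generators of `𝕋(𝒰)` and uniqueness of the point attached to `ρ`

Route `SkinnerWilesDefectOne`, support item stmt-Langlands-14718
(`ProModularOfEisensteinSeed : EisensteinProModularSeed → ReducibleOrdinaryProModular`).  The seed, the
engine and Skinner–Wiles' pro-modular primes all speak of ring homomorphisms out of the
completed-cohomology Hecke algebra `𝕋(𝒰) = CompletedCohomologyHeckeAlgebraGLn 𝒰` ASSOCIATED with a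
Galois representation (`TameLevel.IsAssociated`: `charpoly ρ(Frob_v) = X² − x(T_{v,1}) X + q_v x(T_{v,2})`
for `v ∉ S`).  Association only constrains `x` on `T_{v,1}, …, T_{v,n}`; to move between POINTS of
`𝕋(𝒰)` (seed / engine) and PRIMES of `R_𝒟` ([SW, §4.1]) one needs to know `x` on ALL topological
generators of `𝕋(𝒰)` — the `T_{v,i}` for every `i ≥ 0` and the operators of `t_{v,n}⁻¹`
(`TameLevel.heckeGenerators`).  This file supplies the missing identities in `𝕋(𝒰)` and draws the
consequence:

* `heckeT_eq_of_le` — `T_{v,i} = T_{v,n}` for `i ≥ n` (`t_{v,i} = t_{v,n}`);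
* `heckeOperator_one`, `heckeT_zero` — `t_{v,0} = 1` and `[U 1 U] = id`, so `T_{v,0} = 1`;
* `heckeOperator_inv_mul_self`, `heckeOperator_self_mul_inv` — `t_{v,n} = diag(ϖ_v, …, ϖ_v)` is CENTRAL,
  so `[U t⁻¹ U][U t U] = [U t⁻¹ t U] = id` (Shimura's central twist, the tree's
  `doubleCosetOperator_central_mul`, pushed to `H^i(X_{U_r}, ℤ/p^s)` by functoriality as in the tree's
  `heckeOnCohomology_comm`): the second kind of generator is a two-sided inverse of `T_{v,n}` in `𝕋(𝒰)`;
* `ringHom_ext_of_eqOn_heckeT` — **two CONTINUOUS ring homomorphisms `𝕋(𝒰) → A` into a Hausdorff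
  topological ring that agree on the `T_{v,i}`, `v ∉ S`, `1 ≤ i ≤ n`, are equal** (they agree on every
  generator by the identities above, hence on the generated subring, which is dense);
* `eq_of_isAssociated` — hence **the continuous point of `𝕋(𝒰)` associated with a rank-two `ρ` is
  UNIQUE** as soon as the `q_v` (`v ∉ S`) are non-zero-divisors in `A` (compare the coefficients of
  `X² − a₁ X + q a₂` at an arithmetic Frobenius, which exists): the witness in
  `TameLevel.IsPadicallyAutomorphic ρ` / `IsProModularPrimeAt` is canonical ("THE eigensystem of `ρ`").

References: G. Shimura, *Introduction to the arithmetic theory of automorphic functions* (1971),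
Prop. 3.17 (central twist); T. Gee, J. Newton, *Patching and the completed homology of locally
symmetric spaces*, JIMJ 21 (2022), §2.1.1 (the generators of `𝕋^S`); C. M. Skinner, A. J. Wiles,
Publ. Math. IHÉS 89 (1999), §4.1. [GeeNewton2020] [SkinnerWiles1999]
-/

set_option linter.dupNamespace false -- project-wide option (lakefile weak.linter.dupNamespace); `Summit.Langlands.Langlands` is the mandated namespace

namespace Summit.Langlands.Langlands.Theorems

open scoped NumberField
open IsDedekindDomain CategoryTheory Polynomial
open Literature.NumberTheory.Automorphic Literature.NumberTheory.Automorphic.BigHeckeGLn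
open Literature.NumberTheory.GaloisRepresentations

noncomputable section

/-! ### The Hecke elements `t_{v,i}` -/

section Elements

variable (n : ℕ) (K : Type) [Field K] [NumberField K]

/-- `t_{v,i} = t_{v,n}` for `i ≥ n` (all `n` diagonal slots carry `ϖ_v`). [folklore] -/
theorem heckeElement_eq_of_le (v : HeightOneSpectrum (𝓞 K)) {i : ℕ} (hi : n ≤ i) :
    heckeElement n K v i = heckeElement n K v n := by
  unfold heckeElement
  congr 1
  funext k
  rw [if_pos (lt_of_lt_of_le k.isLt hi), if_pos k.isLt]

/-- `t_{v,0} = 1`. [folklore] -/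
theorem heckeElement_zero (v : HeightOneSpectrum (𝓞 K)) : heckeElement n K v 0 = 1 := by
  unfold heckeElement
  have h : (fun k : Fin n => if k.val < 0 then uniformizerIdele K v (uniformizerAt v) else 1) = 1 := by
    funext k
    rw [if_neg (Nat.not_lt_zero _)]
    rfl
  rw [h, map_one]

/-- `t_{v,n} = diag(ϖ_v, …, ϖ_v)` is a scalar idele matrix, hence CENTRAL in `GL_n(𝔸_K^∞)`.
[folklore] -/
theorem mul_heckeElement_self_comm (v : HeightOneSpectrum (𝓞 K)) (g : FiniteAdelicGL n K) :
    g * heckeElement n K v n = heckeElement n K v n * g := by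
  apply Units.ext
  have hc : ((heckeElement n K v n : FiniteAdelicGL n K) : Matrix (Fin n) (Fin n) _) =
      ((uniformizerIdele K v (uniformizerAt v) : (FiniteAdeleRing (𝓞 K) K)ˣ) :
        FiniteAdeleRing (𝓞 K) K) • (1 : Matrix (Fin n) (Fin n) (FiniteAdeleRing (𝓞 K) K)) := by
    rw [heckeElement, coe_glDiagonal, Matrix.smul_one_eq_diagonal]
    congr 1
    funext k
    rw [if_pos k.isLt]
  rw [Units.val_mul, Units.val_mul, hc, Matrix.mul_smul, Matrix.smul_mul, Matrix.mul_one,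
    Matrix.one_mul]

end Elements

/-! ### Identities among the operators -/

section Operators

variable {n : ℕ} {K : Type} [Field K] [NumberField K]
variable (U : Subgroup (FiniteAdelicGL n K)) (k : Type) [CommRing k]
  [IsHeckeTriple (⊤ : Submonoid (FiniteAdelicGL n K)) U U]

/-- `heckeEnd U k 1 = id` (`[U 1 U] = [U]` is the identity correspondence). [folklore] -/
theorem heckeEnd_one : heckeEnd U k (1 : FiniteAdelicGL n K) = 1 := by
  rw [heckeEnd, heckeAlgebra.doubleCosetOperator_one]
  change (LinearMap.id : Module.End k (MonoidAlgebra k (FiniteAdelicGL n K ⧸ U))).dualMap = 1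
  rw [LinearMap.dualMap_id]
  rfl

/-- **Central twist for `heckeEnd`**: for `z` central, `heckeEnd g * heckeEnd z = heckeEnd (z g)`
(transpose of Shimura's `T_z T_g = T_{z g}`, the tree's `doubleCosetOperator_central_mul`). [folklore] -/
theorem heckeEnd_mul_of_central {z : FiniteAdelicGL n K} (hz : ∀ x : FiniteAdelicGL n K, x * z = z * x)
    (g : FiniteAdelicGL n K) : heckeEnd U k g * heckeEnd U k z = heckeEnd U k (z * g) := by
  rw [heckeEnd, heckeEnd, heckeEnd, ← heckeAlgebra.doubleCosetOperator_central_mul U hz g,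
    Subalgebra.coe_mul, Module.End.mul_eq_comp, Module.End.mul_eq_comp, LinearMap.dualMap_comp_dualMap]

/-- The Hecke operator of `1` on `H^i(X_U, k)` is the identity. [folklore] -/
theorem heckeOnCohomology_one (i : ℕ) : heckeOnCohomology U k (1 : FiniteAdelicGL n K) i = 1 := by
  have hrep : Rep.ofHom (heckeIntertwining U k (1 : FiniteAdelicGL n K)) = 𝟙 (Rep.of (levelRep U k)) :=
    Rep.hom_ext (Representation.IntertwiningMap.ext (by
      change heckeEnd U k (1 : FiniteAdelicGL n K) = LinearMap.id
      rw [heckeEnd_one]; rfl))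
  change ((groupCohomology.functor k (GL (Fin n) K) i).map (Rep.ofHom (heckeIntertwining U k 1))).hom = 1
  rw [hrep, CategoryTheory.Functor.map_id, ModuleCat.hom_id]
  rfl

/-- Multiplicativity of the Hecke operators on `H^i(X_U, k)` along a product formula for `heckeEnd`
(functoriality of group cohomology). [folklore] -/
theorem heckeOnCohomology_mul_eq {g g' g'' : FiniteAdelicGL n K}
    (h : heckeEnd U k g * heckeEnd U k g' = heckeEnd U k g'') (i : ℕ) :
    heckeOnCohomology U k g i * heckeOnCohomology U k g' i = heckeOnCohomology U k g'' i := by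
  have hrep : Rep.ofHom (heckeIntertwining U k g') ≫ Rep.ofHom (heckeIntertwining U k g) =
      Rep.ofHom (heckeIntertwining U k g'') :=
    Rep.hom_ext (Representation.IntertwiningMap.ext h)
  have := congrArg (fun f => ((groupCohomology.functor k (GL (Fin n) K) i).map f).hom) hrep
  simp only [Functor.map_comp, ModuleCat.hom_comp] at this
  exact this

end Operators

/-! ### Identities in `𝕋(𝒰)` -/

section BigHecke

variable {n : ℕ} {K : Type} [Field K] [NumberField K] {p : ℕ} [Fact p.Prime]
variable (𝒰 : TameLevel n K p)

/-- `T_{v,i} = T_{v,n}` in `𝕋(𝒰)` for `i ≥ n`. [folklore] -/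
theorem heckeT_eq_of_le (v : HeightOneSpectrum (𝓞 K)) {i : ℕ} (hi : n ≤ i) :
    𝒰.heckeT v i = 𝒰.heckeT v n := by
  classical
  unfold TameLevel.heckeT
  split_ifs with hv
  · rfl
  · apply Subtype.ext
    change 𝒰.heckeOperator (heckeElement n K v i) = 𝒰.heckeOperator (heckeElement n K v n)
    rw [heckeElement_eq_of_le n K v hi]

/-- The family of Hecke operators of `1 ∈ GL_n(𝔸_K^∞)` is `1`. [folklore] -/
theorem heckeOperator_one : 𝒰.heckeOperator (1 : FiniteAdelicGL n K) = 1 := by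
  funext idx
  exact heckeOnCohomology_one (𝒰.tower idx.1) (ZMod (p ^ idx.2.1)) idx.2.2

/-- `T_{v,0} = 1` in `𝕋(𝒰)` for `v ∉ S`. [folklore] -/
theorem heckeT_zero {v : HeightOneSpectrum (𝓞 K)} (hv : v ∉ 𝒰.bad) : 𝒰.heckeT v 0 = 1 := by
  apply Subtype.ext
  rw [𝒰.coe_heckeT hv 0, heckeElement_zero, heckeOperator_one]
  rfl

/-- **The operator of `t_{v,n}⁻¹` is a left inverse of `T_{v,n}`** in the product ring:
`[U t⁻¹ U] ∘ [U t U] = id`. [folklore] -/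
theorem heckeOperator_inv_mul_self (v : HeightOneSpectrum (𝓞 K)) :
    𝒰.heckeOperator (heckeElement n K v n)⁻¹ * 𝒰.heckeOperator (heckeElement n K v n) = 1 := by
  funext idx
  change heckeOnCohomology _ _ _ _ * heckeOnCohomology _ _ _ _ = 1
  have hz : ∀ x : FiniteAdelicGL n K, x * heckeElement n K v n = heckeElement n K v n * x :=
    mul_heckeElement_self_comm n K v
  rw [heckeOnCohomology_mul_eq (𝒰.tower idx.1) (ZMod (p ^ idx.2.1))
    (heckeEnd_mul_of_central (𝒰.tower idx.1) (ZMod (p ^ idx.2.1)) hz (heckeElement n K v n)⁻¹) idx.2.2,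
    mul_inv_cancel, heckeOnCohomology_one]

/-- **… and a right inverse**: `[U t U] ∘ [U t⁻¹ U] = id` (`t⁻¹` is central too). [folklore] -/
theorem heckeOperator_self_mul_inv (v : HeightOneSpectrum (𝓞 K)) :
    𝒰.heckeOperator (heckeElement n K v n) * 𝒰.heckeOperator (heckeElement n K v n)⁻¹ = 1 := by
  funext idx
  change heckeOnCohomology _ _ _ _ * heckeOnCohomology _ _ _ _ = 1
  have hz : ∀ x : FiniteAdelicGL n K, x * (heckeElement n K v n)⁻¹ = (heckeElement n K v n)⁻¹ * x := by
    intro x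
    have h := mul_heckeElement_self_comm n K v x
    calc x * (heckeElement n K v n)⁻¹
        = (heckeElement n K v n)⁻¹ * (heckeElement n K v n * x) * (heckeElement n K v n)⁻¹ := by group
      _ = (heckeElement n K v n)⁻¹ * (x * heckeElement n K v n) * (heckeElement n K v n)⁻¹ := by rw [h]
      _ = (heckeElement n K v n)⁻¹ * x := by group
  rw [heckeOnCohomology_mul_eq (𝒰.tower idx.1) (ZMod (p ^ idx.2.1))
    (heckeEnd_mul_of_central (𝒰.tower idx.1) (ZMod (p ^ idx.2.1)) hz (heckeElement n K v n)) idx.2.2,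
    inv_mul_cancel, heckeOnCohomology_one]

/-- For `v ∉ S` the operator of `t_{v,n}⁻¹` lies in `𝕋(𝒰)`. [folklore] -/
theorem heckeOperator_inv_mem {v : HeightOneSpectrum (𝓞 K)} (hv : v ∉ 𝒰.bad) :
    𝒰.heckeOperator (heckeElement n K v n)⁻¹ ∈ 𝒰.bigHeckeSubring :=
  (Subring.closure 𝒰.heckeGenerators).le_topologicalClosure
    (Subring.subset_closure (Or.inr ⟨v, hv, rfl⟩))

/-- **`T_{v,n}` is a unit of `𝕋(𝒰)`** (`v ∉ S`), with inverse the operator of `t_{v,n}⁻¹`. [folklore] -/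
theorem heckeOperator_inv_mul_heckeT {v : HeightOneSpectrum (𝓞 K)} (hv : v ∉ 𝒰.bad) :
    (⟨𝒰.heckeOperator (heckeElement n K v n)⁻¹, heckeOperator_inv_mem 𝒰 hv⟩ :
        CompletedCohomologyHeckeAlgebraGLn 𝒰) * 𝒰.heckeT v n = 1 := by
  apply Subtype.ext
  rw [Subring.coe_mul, 𝒰.coe_heckeT hv n, heckeOperator_inv_mul_self]
  rfl

/-- (right-inverse form) [folklore] -/
theorem heckeT_mul_heckeOperator_inv {v : HeightOneSpectrum (𝓞 K)} (hv : v ∉ 𝒰.bad) :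
    𝒰.heckeT v n * (⟨𝒰.heckeOperator (heckeElement n K v n)⁻¹, heckeOperator_inv_mem 𝒰 hv⟩ :
        CompletedCohomologyHeckeAlgebraGLn 𝒰) = 1 := by
  apply Subtype.ext
  rw [Subring.coe_mul, 𝒰.coe_heckeT hv n, heckeOperator_self_mul_inv]
  rfl

/-! ### Uniqueness of continuous points with prescribed `T_{v,i}` -/

/-- **Two continuous ring homomorphisms `𝕋(𝒰) → A` (Hausdorff `A`) agreeing on the `T_{v,i}`,
`v ∉ S`, `1 ≤ i ≤ n`, are equal.**  They agree on `T_{v,0} = 1`, on `T_{v,i} = T_{v,n}` (`i ≥ n`) and on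
the operators of `t_{v,n}⁻¹` (two-sided inverses of the unit `T_{v,n}`), hence on the subring
generated by `heckeGenerators`, which is dense in `𝕋(𝒰)`. [folklore] -/
theorem ringHom_ext_of_eqOn_heckeT {A : Type*} [Ring A] [TopologicalSpace A] [T2Space A]
    {x y : CompletedCohomologyHeckeAlgebraGLn 𝒰 →+* A} (hx : Continuous x) (hy : Continuous y)
    (h : ∀ v ∉ 𝒰.bad, ∀ i, 1 ≤ i → i ≤ n → x (𝒰.heckeT v i) = y (𝒰.heckeT v i)) : x = y := by
  -- agreement on all `T_{v,i}`
  have hT : ∀ v ∉ 𝒰.bad, ∀ i, x (𝒰.heckeT v i) = y (𝒰.heckeT v i) := by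
    intro v hv i
    rcases Nat.eq_zero_or_pos i with rfl | hi
    · rw [heckeT_zero 𝒰 hv, map_one, map_one]
    · rcases le_or_gt i n with hin | hin
      · exact h v hv i hi hin
      · rw [heckeT_eq_of_le 𝒰 v hin.le]
        rcases Nat.eq_zero_or_pos n with hn | hn
        · -- `n = 0`: `T_{v,0} = 1`
          subst hn
          rw [heckeT_zero 𝒰 hv, map_one, map_one]
        · exact h v hv n hn le_rfl
  -- agreement on the inverse generators
  have hinv : ∀ v (hv : v ∉ 𝒰.bad),
      x ⟨𝒰.heckeOperator (heckeElement n K v n)⁻¹, heckeOperator_inv_mem 𝒰 hv⟩ =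
        y ⟨𝒰.heckeOperator (heckeElement n K v n)⁻¹, heckeOperator_inv_mem 𝒰 hv⟩ := by
    intro v hv
    have h1 := congrArg x (heckeOperator_inv_mul_heckeT 𝒰 hv)
    have h2 := congrArg y (heckeT_mul_heckeOperator_inv 𝒰 hv)
    rw [map_mul, map_one] at h1 h2
    rw [hT v hv n] at h1
    -- `x(S) · u = 1` and `u · y(S) = 1` with `u = y(T_{v,n})`
    exact left_inv_eq_right_inv h1 h2
  -- agreement on the generated subring (as a subset of `𝕋(𝒰)`)
  have hgen : ∀ (a : 𝒰.bigEnd) (ha : a ∈ Subring.closure 𝒰.heckeGenerators),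
      x ⟨a, (Subring.closure 𝒰.heckeGenerators).le_topologicalClosure ha⟩ =
        y ⟨a, (Subring.closure 𝒰.heckeGenerators).le_topologicalClosure ha⟩ := by
    intro a ha
    induction ha using Subring.closure_induction with
    | mem a ha =>
      rcases ha with ⟨v, hv, i, rfl⟩ | ⟨v, hv, rfl⟩
      · have e : (⟨𝒰.heckeOperator (heckeElement n K v i), (Subring.closure 𝒰.heckeGenerators).le_topologicalClosure
            (Subring.subset_closure (Or.inl ⟨v, hv, i, rfl⟩))⟩ : CompletedCohomologyHeckeAlgebraGLn 𝒰) =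
            𝒰.heckeT v i := Subtype.ext (by rw [𝒰.coe_heckeT hv i])
        rw [e]
        exact hT v hv i
      · exact hinv v hv
    | zero =>
      have e : (⟨(0 : 𝒰.bigEnd), (Subring.closure 𝒰.heckeGenerators).le_topologicalClosure
          (Subring.closure 𝒰.heckeGenerators).zero_mem⟩ : CompletedCohomologyHeckeAlgebraGLn 𝒰) = 0 := rfl
      rw [e, map_zero, map_zero]
    | one =>
      have e : (⟨(1 : 𝒰.bigEnd), (Subring.closure 𝒰.heckeGenerators).le_topologicalClosure
          (Subring.closure 𝒰.heckeGenerators).one_mem⟩ : CompletedCohomologyHeckeAlgebraGLn 𝒰) = 1 := rfl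
      rw [e, map_one, map_one]
    | add a b ha hb iha ihb =>
      have e : (⟨a + b, (Subring.closure 𝒰.heckeGenerators).le_topologicalClosure
          ((Subring.closure 𝒰.heckeGenerators).add_mem ha hb)⟩ : CompletedCohomologyHeckeAlgebraGLn 𝒰) =
          ⟨a, (Subring.closure 𝒰.heckeGenerators).le_topologicalClosure ha⟩ +
            ⟨b, (Subring.closure 𝒰.heckeGenerators).le_topologicalClosure hb⟩ := rfl
      rw [e, map_add, map_add, iha, ihb]
    | neg a ha iha =>
      have e : (⟨-a, (Subring.closure 𝒰.heckeGenerators).le_topologicalClosure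
          ((Subring.closure 𝒰.heckeGenerators).neg_mem ha)⟩ : CompletedCohomologyHeckeAlgebraGLn 𝒰) =
          -⟨a, (Subring.closure 𝒰.heckeGenerators).le_topologicalClosure ha⟩ := rfl
      rw [e, map_neg, map_neg, iha]
    | mul a b ha hb iha ihb =>
      have e : (⟨a * b, (Subring.closure 𝒰.heckeGenerators).le_topologicalClosure
          ((Subring.closure 𝒰.heckeGenerators).mul_mem ha hb)⟩ : CompletedCohomologyHeckeAlgebraGLn 𝒰) =
          ⟨a, (Subring.closure 𝒰.heckeGenerators).le_topologicalClosure ha⟩ *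
            ⟨b, (Subring.closure 𝒰.heckeGenerators).le_topologicalClosure hb⟩ := rfl
      rw [e, map_mul, map_mul, iha, ihb]
  -- density of the generated subring in its topological closure
  have hdense : Dense {t : CompletedCohomologyHeckeAlgebraGLn 𝒰 |
      (t : 𝒰.bigEnd) ∈ Subring.closure 𝒰.heckeGenerators} := by
    have : Dense ((Subtype.val : CompletedCohomologyHeckeAlgebraGLn 𝒰 → 𝒰.bigEnd) ⁻¹'
        (Subring.closure 𝒰.heckeGenerators : Set 𝒰.bigEnd)) := by
      rw [Subtype.dense_iff]
      intro t ht
      have hsub : (Subring.closure 𝒰.heckeGenerators : Set 𝒰.bigEnd) ⊆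
          (Subtype.val : CompletedCohomologyHeckeAlgebraGLn 𝒰 → 𝒰.bigEnd) ''
            ((Subtype.val : CompletedCohomologyHeckeAlgebraGLn 𝒰 → 𝒰.bigEnd) ⁻¹'
              (Subring.closure 𝒰.heckeGenerators : Set 𝒰.bigEnd)) := by
        intro a ha
        exact ⟨⟨a, (Subring.closure 𝒰.heckeGenerators).le_topologicalClosure ha⟩, ha, rfl⟩
      refine closure_mono hsub ?_
      exact ht
    exact this
  refine RingHom.ext fun t => ?_
  exact congrFun (Continuous.ext_on hdense hx hy fun t ht => hgen t.1 ht) t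

/-- **Uniqueness of the continuous point associated with a rank-two `ρ`.**  If the residue
cardinalities `q_v`, `v ∉ S`, are non-zero-divisors in the Hausdorff topological ring `A` (e.g. `A`
a domain of characteristic `0` or `p`, as `ℚ̄_p` or `R_𝒟/𝔮`), two continuous ring homomorphisms
`𝕋(𝒰) → A` with which the same `ρ : Γ_K → GL₂(A)` is associated coincide: at an arithmetic
Frobenius `σ` over `v` (which exists) both give `charpoly ρ(σ) = X² − x(T_{v,1}) X + q_v x(T_{v,2})`,
so they agree on `T_{v,1}`, `T_{v,2}`. [folklore] -/
theorem eq_of_isAssociated {A : Type*} [CommRing A] [TopologicalSpace A] [T2Space A]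
    (𝒰 : TameLevel 2 K p) {x y : CompletedCohomologyHeckeAlgebraGLn 𝒰 →+* A}
    (hx : Continuous x) (hy : Continuous y) (ρ : FramedGaloisRep K A 2)
    (hxρ : 𝒰.IsAssociated x ρ) (hyρ : 𝒰.IsAssociated y ρ)
    (hq : ∀ v ∉ 𝒰.bad, (Ideal.absNorm v.asIdeal : A) ∈ nonZeroDivisors A) : x = y := by
  refine ringHom_ext_of_eqOn_heckeT 𝒰 hx hy fun v hv i hi1 hi2 => ?_
  obtain ⟨𝔓, h𝔓⟩ := v.primesAbove_nonempty
  obtain ⟨σ, hσ⟩ := HeightOneSpectrum.exists_isArithFrobAt_of_mem_primesAbove_holds h𝔓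
  have hxc := (hxρ v hv).2 𝔓 h𝔓 σ hσ
  have hyc := (hyρ v hv).2 𝔓 h𝔓 σ hσ
  have hpoly : heckeFrobPoly 2 (Ideal.absNorm v.asIdeal) (fun i => x (𝒰.heckeT v i)) =
      heckeFrobPoly 2 (Ideal.absNorm v.asIdeal) (fun i => y (𝒰.heckeT v i)) := by
    rw [← hxc, ← hyc]
  have h2 : Finset.Icc 1 2 = {1, 2} := by decide
  simp only [heckeFrobPoly, h2, Finset.sum_insert (show (1 : ℕ) ∉ ({2} : Finset ℕ) by decide),
    Finset.sum_singleton] at hpoly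
  -- compare coefficients of `X¹` and `X⁰`
  have h1 := congrArg (fun P : Polynomial A => P.coeff 1) hpoly
  have h0 := congrArg (fun P : Polynomial A => P.coeff 0) hpoly
  simp only [coeff_add, coeff_C_mul, coeff_X_pow, Nat.succ_sub_succ_eq_sub, tsub_zero,
    pow_zero, pow_one, mul_one] at h1 h0
  norm_num at h1 h0
  interval_cases i
  · -- `i = 1`: coefficient of `X`
    exact h1
  · -- `i = 2`: constant coefficient `q · a₂`
    exact (mul_cancel_left_mem_nonZeroDivisors (hq v hv)).mp h0

end BigHecke

end

end Summit.Langlands.Langlands.Theorems
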